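import Summits.AtomisticToContinuum.Crystallization.Theorems.ExcessDecayLiouvilleHcpLiouvilleBlowdownSecantRows

/-!
# `ExcessDecayLiouville.HcpLiouville` (stmt-AtomisticToContinuum-9332), line `Sketch` (skeleton v4): stub `stub_improvement`

The GLUE of the blow-down level 2 (crux `HcpLiouville`, stub (G) `stub_improvement`): from the four analytic
interfaces `Blowdown.CaccioppoliProp ρ C_C`, `Blowdown.RemainderProp C_R`, `Blowdown.GreenProp κ C_F`,
`Blowdown.InteriorDecayProp κ C_D` (hypotheses) to one step `Blowdown.ImprovementProp θ R₀ K` of the excess-decay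
iteration for the displacement `v = LevelOne.vField t A τ u` on the anchored sites `S* = Sites₀ (anchorDatum t τ) A`:

* pure real arithmetic: `Blowdown.z_bound_arith` (the `ℓ²`-size `Z` of the corrector is `≤ C₃ R⁻¹ (osc₁₆ + 1)`),
  `Blowdown.improvement_arith` (assembly of the normalised improvement with `θ = (65536 D)⁻¹`);
* `Blowdown.oscAt_eq_sum_sites` (the squared oscillation as a `Finset` sum over the site subtype of the ball) and
  its three comparison lemmas (pointwise in the constant, monotone in the radius, `‖a‖² ≤ 2‖a + b‖² + 2‖b‖²`
  against an `ℓ²` field);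
* `Blowdown.isHarmonicOn_add` (`v + z₁` is exactly `L`-harmonic on the ball when `L z₁ = div M` solves away the
  truncated remainder `M`);
* `stub_improvement` — the registered signature.

All `[folklore]`; a `--supports` helper for item stmt-AtomisticToContinuum-9332, nothing here closes an item.
-/

noncomputable section

namespace Summit.AtomisticToContinuum.Crystallization.Theorems.ExcessDecayLiouville

open scoped BigOperators Topology Classical InnerProductSpace RealInnerProductSpace
open Literature.MathematicalPhysics.StatisticalMechanics
open Summit.AtomisticToContinuum.Crystallization.Theses.ExcessDecayLiouville
open Summit.AtomisticToContinuum.Crystallization.Theorems.PhononStabilityNegative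

namespace Blowdown

open LevelOne

/-! ## Pure real arithmetic -/

/-- **Size of the corrector**: from `osc₁₆ ≤ (121/100)·32·(16R)³`, the Caccioppoli bound
`E ≤ C ((4R)⁻² osc₁₆ + (4R)⁻²)`, the remainder bound `N ≤ Cr (E + R⁻²)` and the Green bound `Z ≤ F N²`
(`C, Cr, F ≥ 1`, `R ≥ 1`): `Z ≤ F Cr² (C + 1)² · 158599 · R⁻¹ · (osc₁₆ + 1)`. [folklore] -/
theorem z_bound_arith {C Cr F R O E N Z : ℝ} (hC : 1 ≤ C) (hCr : 1 ≤ Cr) (hF : 1 ≤ F) (hR : 1 ≤ R)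
    (hO : 0 ≤ O) (hO' : O ≤ 121 / 100 * (32 * (16 * R) ^ 3))
    (hE : E ≤ C * ((4 * R)⁻¹ ^ 2 * O + (4 * R)⁻¹ ^ 2))
    (hN0 : 0 ≤ N) (hN : N ≤ Cr * (E + R⁻¹ ^ 2)) (hZ : Z ≤ F * N ^ 2) :
    Z ≤ F * Cr ^ 2 * (C + 1) ^ 2 * 158599 * R⁻¹ * (O + 1) := by
  have hR0 : 0 < R := by linarith
  rw [show (4 * R)⁻¹ ^ 2 = R⁻¹ ^ 2 / 16 by rw [mul_inv, mul_pow]; ring] at hE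
  set y := R⁻¹ with hy
  have hy0 : 0 < y := inv_pos.2 hR0
  have hRy : R * y = 1 := mul_inv_cancel₀ hR0.ne'
  have hC0 : 0 ≤ C := by linarith
  have h1a : E ≤ C * y ^ 2 * (O + 1) := by
    have : 0 ≤ C * (y ^ 2 * (O + 1)) := by positivity
    linarith [hE, this]
  have h1b : y ^ 2 ≤ y ^ 2 * (O + 1) := by
    have : 0 ≤ y ^ 2 * O := by positivity
    linarith [this]
  have h1 : E + y ^ 2 ≤ (C + 1) * y ^ 2 * (O + 1) := by linarith [h1a, h1b]
  have hNW : N ≤ Cr * (C + 1) * y ^ 2 * (O + 1) := by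
    have := mul_le_mul_of_nonneg_left h1 (by linarith : (0 : ℝ) ≤ Cr)
    linarith [hN, this]
  have hN2 : N ^ 2 ≤ (Cr * (C + 1) * y ^ 2 * (O + 1)) ^ 2 := pow_le_pow_left₀ hN0 hNW 2
  have hO1 : O + 1 ≤ 158599 * R ^ 3 := by
    have : 1 ≤ R ^ 3 := one_le_pow₀ hR
    linarith [hO', this]
  have hF0 : 0 ≤ F := by linarith
  have hL0 : 0 ≤ F * Cr ^ 2 * (C + 1) ^ 2 * (y ^ 4 * (O + 1)) := by positivity
  calc Z ≤ F * N ^ 2 := hZ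
    _ ≤ F * (Cr * (C + 1) * y ^ 2 * (O + 1)) ^ 2 := mul_le_mul_of_nonneg_left hN2 hF0
    _ = F * Cr ^ 2 * (C + 1) ^ 2 * (y ^ 4 * (O + 1)) * (O + 1) := by ring
    _ ≤ F * Cr ^ 2 * (C + 1) ^ 2 * (y ^ 4 * (O + 1)) * (158599 * R ^ 3) :=
        mul_le_mul_of_nonneg_left hO1 hL0
    _ = F * Cr ^ 2 * (C + 1) ^ 2 * 158599 * y * (O + 1) * (R * y) ^ 3 := by ring
    _ = F * Cr ^ 2 * (C + 1) ^ 2 * 158599 * y * (O + 1) := by rw [hRy]; ring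

/-- **Assembly of the improvement step** (pure real arithmetic): with `θ ≤ (65536 D)⁻¹`, `R ≥ 16384 (6D + 2θ⁻³) C₃`,
the corrector size `Z ≤ C₃ R⁻¹ (O + 1)`, the comparison `O₂ ≤ 2O + 2Z`, the interior estimate
`P ≤ D ((θR/R)⁴ O₂ + (θR)⁵ (4R⁻⁶ + Z R⁻⁸))` and `Q ≤ 2P + 2Z`:
`(θR)⁻³ Q ≤ ½ (16R)⁻³ O + (8D + (6D + 2θ⁻³) C₃) R⁻⁴`. [folklore] -/
theorem improvement_arith {D C₃ θ R O Z O₂ P Q : ℝ} (hD : 1 ≤ D) (hθ : 0 < θ) (hθ1 : θ ≤ 1)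
    (hθD : 65536 * D * θ ≤ 1) (hR : 1 ≤ R) (hRZ : 16384 * ((6 * D + 2 * θ⁻¹ ^ 3) * C₃) ≤ R)
    (hO : 0 ≤ O) (hZ0 : 0 ≤ Z) (hZ : Z ≤ C₃ * R⁻¹ * (O + 1))
    (hO₂ : O₂ ≤ 2 * O + 2 * Z)
    (hP : P ≤ D * ((θ * R / R) ^ 4 * O₂ + (θ * R) ^ 5 * (2 ^ 2 * R⁻¹ ^ 6 + Z * R⁻¹ ^ 8)))
    (hQ : Q ≤ 2 * P + 2 * Z) :
    (θ * R)⁻¹ ^ 3 * Q ≤ 1 / 2 * ((16 * R)⁻¹ ^ 3 * O) + (8 * D + (6 * D + 2 * θ⁻¹ ^ 3) * C₃) * R⁻¹ ^ 4 := by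
  have hR0 : 0 < R := by linarith
  rw [mul_div_assoc, div_self hR0.ne', mul_one] at hP
  rw [show (θ * R)⁻¹ ^ 3 = θ⁻¹ ^ 3 * R⁻¹ ^ 3 by rw [mul_inv, mul_pow],
    show (16 * R)⁻¹ ^ 3 = R⁻¹ ^ 3 / 4096 by rw [mul_inv, mul_pow]; ring]
  set y := R⁻¹ with hy
  set ti := θ⁻¹ with hti
  have hy0 : 0 < y := inv_pos.2 hR0
  have hy1 : y ≤ 1 := inv_le_one_of_one_le₀ hR
  have hRy : R * y = 1 := mul_inv_cancel₀ hR0.ne'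
  have hti0 : 0 < ti := inv_pos.2 hθ
  have hθti : θ * ti = 1 := mul_inv_cancel₀ hθ.ne'
  have hD0 : 0 ≤ D := by linarith
  have e1 : (θ * R) ^ 5 * (2 ^ 2 * y ^ 6 + Z * y ^ 8) = θ ^ 5 * (4 * y + Z * y ^ 3) := by
    have : (θ * R) ^ 5 * (2 ^ 2 * y ^ 6 + Z * y ^ 8) = θ ^ 5 * ((R * y) ^ 5 * (4 * y + Z * y ^ 3)) := by
      ring
    rw [this, hRy]; ring
  rw [e1] at hP
  -- the interior estimate with `O₂ ≤ 2O + 2Z` inserted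
  have hP' : P ≤ D * θ ^ 4 * (2 * O + 2 * Z) + D * θ ^ 5 * (4 * y + Z * y ^ 3) := by
    have hθ4 : 0 ≤ D * θ ^ 4 := by positivity
    have := mul_le_mul_of_nonneg_left hO₂ hθ4
    linarith [this, hP]
  have hcoef : 0 ≤ ti ^ 3 * y ^ 3 := by positivity
  have h1 : ti ^ 3 * y ^ 3 * Q ≤ ti ^ 3 * y ^ 3 * (2 * P + 2 * Z) := mul_le_mul_of_nonneg_left hQ hcoef
  have e4 : ti ^ 3 * y ^ 3 * (2 * (D * θ ^ 4 * (2 * O + 2 * Z) + D * θ ^ 5 * (4 * y + Z * y ^ 3)) + 2 * Z) =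
      4 * D * θ * y ^ 3 * O + (4 * D * θ * y ^ 3 + 2 * D * θ ^ 2 * y ^ 6 + 2 * ti ^ 3 * y ^ 3) * Z +
        8 * D * θ ^ 2 * y ^ 4 := by
    have : ti ^ 3 * y ^ 3 * (2 * (D * θ ^ 4 * (2 * O + 2 * Z) + D * θ ^ 5 * (4 * y + Z * y ^ 3)) + 2 * Z) =
        4 * D * ((θ * ti) ^ 3 * θ) * y ^ 3 * O +
          (4 * D * ((θ * ti) ^ 3 * θ) * y ^ 3 + 2 * D * ((θ * ti) ^ 3 * θ ^ 2) * y ^ 6 +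
            2 * ti ^ 3 * y ^ 3) * Z +
          8 * D * ((θ * ti) ^ 3 * θ ^ 2) * y ^ 4 := by ring
    rw [this, hθti]; ring
  have h2 : ti ^ 3 * y ^ 3 * (2 * P + 2 * Z) ≤
      4 * D * θ * y ^ 3 * O + (4 * D * θ * y ^ 3 + 2 * D * θ ^ 2 * y ^ 6 + 2 * ti ^ 3 * y ^ 3) * Z +
        8 * D * θ ^ 2 * y ^ 4 := by
    rw [← e4]
    exact mul_le_mul_of_nonneg_left (by linarith [hP']) hcoef
  -- the harmonic term: `4Dθ ≤ 1/16384`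
  have hy3O : 0 ≤ y ^ 3 * O := by positivity
  have h3 : 4 * D * θ * y ^ 3 * O ≤ y ^ 3 * O / 16384 := by
    have := mul_le_mul_of_nonneg_right hθD hy3O
    linarith [this]
  -- the corrector terms
  have h4 : (4 * D * θ * y ^ 3 + 2 * D * θ ^ 2 * y ^ 6 + 2 * ti ^ 3 * y ^ 3) * Z ≤
      (6 * D + 2 * ti ^ 3) * y ^ 3 * Z := by
    apply mul_le_mul_of_nonneg_right _ hZ0
    have hy31 : y ^ 3 ≤ 1 := pow_le_one₀ hy0.le hy1
    have hθ2 : θ ^ 2 ≤ 1 := pow_le_one₀ hθ.le hθ1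
    have hDy : 0 ≤ D * y ^ 3 := by positivity
    have p1 := mul_le_mul_of_nonneg_left hθ1 hDy
    have p2 := mul_le_mul_of_nonneg_left hθ2 hDy
    have p3 := mul_le_mul_of_nonneg_left hy31 (by positivity : 0 ≤ D * θ ^ 2 * y ^ 3)
    linarith [p1, p2, p3]
  have h5 : (6 * D + 2 * ti ^ 3) * y ^ 3 * Z ≤
      (6 * D + 2 * ti ^ 3) * C₃ * y ^ 4 * O + (6 * D + 2 * ti ^ 3) * C₃ * y ^ 4 := by
    have hA₁ : 0 ≤ (6 * D + 2 * ti ^ 3) * y ^ 3 := by positivity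
    calc (6 * D + 2 * ti ^ 3) * y ^ 3 * Z ≤ (6 * D + 2 * ti ^ 3) * y ^ 3 * (C₃ * y * (O + 1)) :=
        mul_le_mul_of_nonneg_left hZ hA₁
      _ = (6 * D + 2 * ti ^ 3) * C₃ * y ^ 4 * O + (6 * D + 2 * ti ^ 3) * C₃ * y ^ 4 := by ring
  have h6 : (6 * D + 2 * ti ^ 3) * C₃ * y ^ 4 * O ≤ y ^ 3 * O / 16384 := by
    have h16 : 16384 * ((6 * D + 2 * ti ^ 3) * C₃) * y ≤ 1 := by
      calc 16384 * ((6 * D + 2 * ti ^ 3) * C₃) * y ≤ R * y := mul_le_mul_of_nonneg_right hRZ hy0.le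
        _ = 1 := hRy
    have := mul_le_mul_of_nonneg_right h16 hy3O
    linarith [this]
  have h7 : 8 * D * θ ^ 2 * y ^ 4 ≤ 8 * D * y ^ 4 := by
    have hθ2 : θ ^ 2 ≤ 1 := pow_le_one₀ hθ.le hθ1
    have h8 : 0 ≤ 8 * D * y ^ 4 := by positivity
    have := mul_le_mul_of_nonneg_left hθ2 h8
    linarith [this]
  linarith [h1, h2, h3, h4, h5, h6, h7]

/-- `a ≤ b + c` with `a, b, c ≥ 0` gives `a² ≤ 2b² + 2c²`. [folklore] -/
theorem sq_le_two_mul_sq_add {a b c : ℝ} (ha : 0 ≤ a) (hb : 0 ≤ b) (hc : 0 ≤ c) (h : a ≤ b + c) :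
    a ^ 2 ≤ 2 * b ^ 2 + 2 * c ^ 2 := by
  have h1 : a * a ≤ (b + c) * (b + c) := mul_le_mul h h ha (by linarith)
  linarith [sq_nonneg (b - c), h1]

/-! ## The squared oscillation as a finite sum over the ball -/

variable {t : Fin 2 → EuclideanSpace ℝ (Fin 3)} {A : EuclideanSpace ℝ (Fin 3) →L[ℝ] EuclideanSpace ℝ (Fin 3)}

/-- `oscAt (Sites₀ t A) w c r m` is the `Finset` sum of `‖w p − m‖²` over the sites of the closed ball
`dist · c ≤ r` (`LevelOne.finite_sites_ball`). [folklore] -/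
theorem oscAt_eq_sum_sites (hA : Adm₀ A) (hI : Inner₀ t A) (w : EuclideanSpace ℝ (Fin 3) → EuclideanSpace ℝ (Fin 3))
    (c : EuclideanSpace ℝ (Fin 3)) (r : ℝ) (m : EuclideanSpace ℝ (Fin 3)) :
    oscAt (Sites₀ t A) w c r m = ∑ p ∈ (finite_sites_ball hA hI c r).toFinset, ‖w p - m‖ ^ 2 := by
  rw [oscAt_eq_tsum_ite, tsum_eq_sum (s := (finite_sites_ball hA hI c r).toFinset)]
  · refine Finset.sum_congr rfl fun p hp => ?_
    simp only [Set.Finite.mem_toFinset, Set.mem_setOf_eq] at hp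
    exact if_pos hp
  · intro p hp
    simp only [Set.Finite.mem_toFinset, Set.mem_setOf_eq] at hp
    exact if_neg hp

/-- **Pointwise comparison in the constant**: if `‖w p − m‖ ≤ ‖w p − m'‖` on the sites then
`oscAt S w c r m ≤ oscAt S w c r m'`. [folklore] -/
theorem oscAt_le_oscAt_of_forall (hA : Adm₀ A) (hI : Inner₀ t A)
    (w : EuclideanSpace ℝ (Fin 3) → EuclideanSpace ℝ (Fin 3)) (c : EuclideanSpace ℝ (Fin 3)) (r : ℝ)
    {m m' : EuclideanSpace ℝ (Fin 3)} (h : ∀ p ∈ Sites₀ t A, ‖w p - m‖ ≤ ‖w p - m'‖) :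
    oscAt (Sites₀ t A) w c r m ≤ oscAt (Sites₀ t A) w c r m' := by
  rw [oscAt_eq_sum_sites hA hI, oscAt_eq_sum_sites hA hI]
  exact Finset.sum_le_sum fun p _ => pow_le_pow_left₀ (norm_nonneg _) (h p p.2) 2

/-- **Monotonicity in the radius**: `oscAt S w c r m ≤ oscAt S w c r' m` for `r ≤ r'`. [folklore] -/
theorem oscAt_mono_radius (hA : Adm₀ A) (hI : Inner₀ t A)
    (w : EuclideanSpace ℝ (Fin 3) → EuclideanSpace ℝ (Fin 3)) (c : EuclideanSpace ℝ (Fin 3)) {r r' : ℝ}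
    (h : r ≤ r') (m : EuclideanSpace ℝ (Fin 3)) :
    oscAt (Sites₀ t A) w c r m ≤ oscAt (Sites₀ t A) w c r' m := by
  rw [oscAt_eq_sum_sites hA hI, oscAt_eq_sum_sites hA hI]
  refine Finset.sum_le_sum_of_subset_of_nonneg (fun p hp => ?_) fun _ _ _ => sq_nonneg _
  simp only [Set.Finite.mem_toFinset, Set.mem_setOf_eq] at hp ⊢
  exact hp.trans h

/-- **Comparison against an `ℓ²` field**: if `‖w p − m‖ ≤ ‖w' p − m'‖ + ‖b p‖` on the sites and `Σ_S ‖b‖² < ∞`,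
then `oscAt S w c r m ≤ 2·oscAt S w' c r m' + 2·Σ_S ‖b‖²`. [folklore] -/
theorem oscAt_le_two_mul_add (hA : Adm₀ A) (hI : Inner₀ t A)
    (w w' b : EuclideanSpace ℝ (Fin 3) → EuclideanSpace ℝ (Fin 3)) (c : EuclideanSpace ℝ (Fin 3)) (r : ℝ)
    (m m' : EuclideanSpace ℝ (Fin 3)) (hb : Summable (fun p : Sites₀ t A => ‖b p‖ ^ 2))
    (h : ∀ p ∈ Sites₀ t A, ‖w p - m‖ ≤ ‖w' p - m'‖ + ‖b p‖) :
    oscAt (Sites₀ t A) w c r m ≤ 2 * oscAt (Sites₀ t A) w' c r m' + 2 * ∑' p : Sites₀ t A, ‖b p‖ ^ 2 := by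
  rw [oscAt_eq_sum_sites hA hI, oscAt_eq_sum_sites hA hI, Finset.mul_sum]
  have h2 : ∑ p ∈ (finite_sites_ball hA hI c r).toFinset, ‖b p‖ ^ 2 ≤ ∑' p : Sites₀ t A, ‖b p‖ ^ 2 :=
    hb.sum_le_tsum _ fun p _ => sq_nonneg _
  calc ∑ p ∈ (finite_sites_ball hA hI c r).toFinset, ‖w p - m‖ ^ 2
      ≤ ∑ p ∈ (finite_sites_ball hA hI c r).toFinset, (2 * ‖w' p - m'‖ ^ 2 + 2 * ‖b p‖ ^ 2) :=
        Finset.sum_le_sum fun p _ =>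
          sq_le_two_mul_sq_add (norm_nonneg _) (norm_nonneg _) (norm_nonneg _) (h p p.2)
    _ = ∑ p ∈ (finite_sites_ball hA hI c r).toFinset, 2 * ‖w' p - m'‖ ^ 2 +
          2 * ∑ p ∈ (finite_sites_ball hA hI c r).toFinset, ‖b p‖ ^ 2 := by
        rw [Finset.sum_add_distrib, ← Finset.mul_sum, ← Finset.mul_sum]
    _ ≤ _ := by linarith

/-! ## Exact harmonicity of the corrected field -/

/-- **`v + z₁` is `L`-harmonic on the ball**: if the rows `Σ_q (K(p − q)(v p − v q) + M p q)` vanish for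
`p` in the ball, the rows of `M` are summable there, and `Σ_q K(p − q)(z₁ p − z₁ q) = Σ_q M p q`, then
`IsHarmonicOn S (v + z₁) c R` (`K(p − q)` is linear: `map_add`). [folklore] -/
theorem isHarmonicOn_add {S : Set (EuclideanSpace ℝ (Fin 3))}
    {v z₁ : EuclideanSpace ℝ (Fin 3) → EuclideanSpace ℝ (Fin 3)}
    {M : EuclideanSpace ℝ (Fin 3) → EuclideanSpace ℝ (Fin 3) → EuclideanSpace ℝ (Fin 3)}
    {c : EuclideanSpace ℝ (Fin 3)} {R : ℝ}
    (hv : ∀ p : S, dist (p : EuclideanSpace ℝ (Fin 3)) c ≤ R →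
      HasSum (fun q : S => forceConst ((p : EuclideanSpace ℝ (Fin 3)) - q) (v p - v q) + M p q) 0)
    (hM : ∀ p : S, dist (p : EuclideanSpace ℝ (Fin 3)) c ≤ R → Summable (fun q : S => M p q))
    (hz : ∀ p : S, HasSum (fun q : S => forceConst ((p : EuclideanSpace ℝ (Fin 3)) - q) (z₁ p - z₁ q))
      (∑' q : S, M p q)) :
    IsHarmonicOn S (fun x => v x + z₁ x) c R := by
  intro p hp
  have h1 : HasSum (fun q : S => forceConst ((p : EuclideanSpace ℝ (Fin 3)) - q) (v p - v q))
      (0 - ∑' q : S, M p q) :=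
    ((hv p hp).sub (hM p hp).hasSum).congr_fun fun q => (add_sub_cancel_right _ _).symm
  have h2 := h1.add (hz p)
  rw [sub_add_cancel] at h2
  refine h2.congr_fun fun q => ?_
  rw [← map_add, add_sub_add_comm]

end Blowdown

/-- **Stub `stub_improvement` (line `Sketch`, skeleton v4, step (G))**: one step of the blow-down iteration from
the four interfaces.  With `D = max C_D 1`, `θ = (65536 D)⁻¹`, `C₃ = max C_F 1 · (max C_R 1)² · (max C_C 1 + 1)² ·
158599`, `A₁ = 6D + 2θ⁻³`, `R₀ = θ⁻¹ + 16384 A₁ C₃`, `K = 8D + A₁ C₃`: the truncated remainder `M` of the exact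
linearised equation (`RemainderProp`) is solved away by `z₁ = L⁻¹ div M` (`GreenProp`), `z₂ = v + z₁` is exactly
`L`-harmonic on `B_R(c)`, the interior estimate (`InteriorDecayProp`, `b = z₁`, `Y₀ = 2`, `Y₂² = Σ‖z₁‖²`) at
`r = θR` is pulled back to `v` (`‖v − m'‖² ≤ 2‖z₂ − m'‖² + 2‖z₁‖²`), the new constant is put back into the unit
ball (`m' ↦ 0` if `‖m'‖ > 1`, harmless as `‖v‖ ≤ 3/40`), and `Σ‖z₁‖² ≤ C₃ R⁻¹ (osc₁₆ + 1)` (Caccioppoli at `4R`,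
`osc₁₆ ≤ C R³`) makes the error relatively small. [folklore] -/
theorem stub_improvement :
    ∀ ρ κ C_C C_R C_F C_D : ℝ, 0 < κ →
      Blowdown.CaccioppoliProp ρ C_C → Blowdown.RemainderProp C_R →
      Blowdown.GreenProp κ C_F → Blowdown.InteriorDecayProp κ C_D →
      ∃ θ R₀ K : ℝ, 0 < θ ∧ θ < 1 ∧ 1 ≤ R₀ ∧
        ∀ (X : Set (EuclideanSpace ℝ (Fin 3))) (t : Fin 2 → EuclideanSpace ℝ (Fin 3))
          (A : EuclideanSpace ℝ (Fin 3) →L[ℝ] EuclideanSpace ℝ (Fin 3))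
          (u : EuclideanSpace ℝ (Fin 3) → EuclideanSpace ℝ (Fin 3)) (τ : EuclideanSpace ℝ (Fin 3)),
          Adm₀ A → Inner₀ t A → Blowdown.PSIneq κ (anchorDatum t τ) A → Equil₀ X → IsDisplacement X t A u →
          ‖τ‖ ≤ ρ → Inner₀ (anchorDatum t τ) A → Equil₀ (Sites₀ (anchorDatum t τ) A) →
            Blowdown.ImprovementProp θ R₀ K (Sites₀ (anchorDatum t τ) A) (LevelOne.vField t A τ u) := by
  intro ρ κ C_C C_R C_F C_D _hκ hC hRm hG hD
  -- the constants (depending on `C_C, C_R, C_F, C_D` only)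
  obtain ⟨D, hD1, hDC⟩ : ∃ D : ℝ, 1 ≤ D ∧ C_D ≤ D := ⟨max C_D 1, le_max_right _ _, le_max_left _ _⟩
  have hD0 : 0 < D := by linarith
  obtain ⟨θ, hθ⟩ : ∃ θ : ℝ, θ = (65536 * D)⁻¹ := ⟨_, rfl⟩
  have hθ0 : 0 < θ := by rw [hθ]; positivity
  have hθinv : θ⁻¹ = 65536 * D := by rw [hθ, inv_inv]
  have hθD : 65536 * D * θ = 1 := by rw [hθ]; exact mul_inv_cancel₀ (by positivity)
  have hθ16 : 16 * θ ≤ 1 := by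
    have := mul_nonneg (by linarith : (0 : ℝ) ≤ 65536 * D - 16) hθ0.le
    linarith
  have hθ1 : θ < 1 := by linarith
  have h65 : (65536 : ℝ) ≤ θ⁻¹ := by rw [hθinv]; linarith
  obtain ⟨C₃, hC₃⟩ : ∃ C₃ : ℝ, C₃ = max C_F 1 * max C_R 1 ^ 2 * (max C_C 1 + 1) ^ 2 * 158599 := ⟨_, rfl⟩
  have hC₃0 : 0 ≤ C₃ := by rw [hC₃]; positivity
  have hAC : 0 ≤ 16384 * ((6 * D + 2 * θ⁻¹ ^ 3) * C₃) := by positivity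
  refine ⟨θ, θ⁻¹ + 16384 * ((6 * D + 2 * θ⁻¹ ^ 3) * C₃), 8 * D + (6 * D + 2 * θ⁻¹ ^ 3) * C₃, hθ0, hθ1,
    by linarith, ?_⟩
  intro X t A u τ hA hI hPS hEX hu hτρ hIτ hEτ c R m hR₀R hm
  have hR16 : 16 ≤ R := by linarith
  have hR1 : 1 ≤ R := by linarith
  have hR0 : 0 < R := by linarith
  have hRZ : 16384 * ((6 * D + 2 * θ⁻¹ ^ 3) * C₃) ≤ R := by linarith
  have hθR : 1 ≤ θ * R := by
    have : θ * θ⁻¹ ≤ θ * R := mul_le_mul_of_nonneg_left (by linarith) hθ0.le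
    rwa [mul_inv_cancel₀ hθ0.ne'] at this
  have h16θR : 16 * (θ * R) ≤ R := by
    have := mul_le_mul_of_nonneg_right hθ16 hR0.le
    linarith
  set S := Sites₀ (anchorDatum t τ) A with hS
  set v := LevelOne.vField t A τ u with hv
  have hτ : ‖τ‖ ≤ 1 / 20 := LevelOne.norm_anchor_le hI hIτ
  -- Step 1: the linearised equation and the remainder bound at `(c, R)`
  obtain ⟨hrow, hrem⟩ := hRm X t A u τ hA hI hEX hu hτ hIτ hEτ
  obtain ⟨hMsum, hM1⟩ := hrem c R hR1
  -- Step 2: the corrector `z₁ = L⁻¹ div M`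
  obtain ⟨z₁, hz₁row, hz₁sum, hZ⟩ := hG (anchorDatum t τ) A hA hIτ hPS (Blowdown.truncRemainder v c R)
    (fun p q => Blowdown.hcpLiouville_blowdown_vocabulary v c R p q) hMsum
  set N₁ := ∑' pq : S × S, ‖Blowdown.truncRemainder v c R pq.1 pq.2‖ *
    (1 + dist (pq.1 : EuclideanSpace ℝ (Fin 3)) pq.2) with hN₁
  set Z := ∑' p : S, ‖z₁ p‖ ^ 2 with hZdef
  have hZ0 : 0 ≤ Z := tsum_nonneg fun _ => sq_nonneg _
  have hN₁0 : 0 ≤ N₁ := tsum_nonneg fun _ => mul_nonneg (norm_nonneg _) (by positivity)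
  -- Step 3: `z₂ = v + z₁` is exactly harmonic on `B_R(c)`
  have hharm : Blowdown.IsHarmonicOn S (fun x => v x + z₁ x) c R := by
    refine Blowdown.isHarmonicOn_add (M := Blowdown.truncRemainder v c R) (fun p hp => ?_) (fun p _ => ?_)
      hz₁row
    · exact (hrow p).congr_fun fun q => by rw [Blowdown.truncRemainder_of_dist_le v hp]
    · have h1 : Summable fun q : S => ‖Blowdown.truncRemainder v c R p q‖ *
          (1 + dist (p : EuclideanSpace ℝ (Fin 3)) q) := hMsum.prod_factor p
      exact Summable.of_norm_bounded h1 fun q =>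
        le_mul_of_one_le_right (norm_nonneg _) (le_add_of_nonneg_right dist_nonneg)
  -- Step 4: Caccioppoli at `(c, 4R, m)`
  have hE := hC X t A u τ hA hI hEX hu hτρ hIτ hEτ c (4 * R) m (by linarith) hm
  rw [show 4 * (4 * R) = 16 * R by ring] at hE
  -- Step 5: interior decay for `z₂` (`b = z₁`, `Y₀ = 2`, `Y₂ = √Z`, `r = θR`)
  have hY₀ : ∀ p ∈ S, ‖(fun x => v x + z₁ x) p - m - z₁ p‖ ≤ 2 := fun p hp => by
    show ‖v p + z₁ p - m - z₁ p‖ ≤ 2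
    rw [show v p + z₁ p - m - z₁ p = v p - m by abel]
    linarith [Blowdown.norm_vField_sub_const_le hA hI hIτ hu hm hp]
  obtain ⟨m', hm'⟩ := hD (anchorDatum t τ) A hA hIτ hPS (fun x => v x + z₁ x) z₁ c m R 2 (Real.sqrt Z) hR16
    (by norm_num) (Real.sqrt_nonneg _) hY₀ hz₁sum (by rw [Real.sq_sqrt hZ0]) hharm (θ * R) hθR h16θR
  rw [Real.sq_sqrt hZ0] at hm'
  -- Step 6: back into the unit ball
  obtain ⟨m'', hm''1, hpt⟩ : ∃ m'' : EuclideanSpace ℝ (Fin 3), ‖m''‖ ≤ 1 ∧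
      ∀ p ∈ S, ‖v p - m''‖ ≤ ‖v p - m'‖ := by
    by_cases h1 : ‖m'‖ ≤ 1
    · exact ⟨m', h1, fun p _ => le_rfl⟩
    · refine ⟨0, by simp, fun p hp => ?_⟩
      rw [sub_zero]
      have h2 := LevelOne.norm_vField_le hA hI hIτ hu hp
      have h3 : ‖m'‖ - ‖v p‖ ≤ ‖v p - m'‖ := by rw [norm_sub_rev]; exact norm_sub_norm_le _ _
      push Not at h1
      linarith
  refine ⟨m'', hm''1, ?_⟩
  -- Step 7: the elementary comparisons
  have hQ : Blowdown.oscAt S v c (θ * R) m'' ≤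
      2 * Blowdown.oscAt S (fun x => v x + z₁ x) c (θ * R) m' + 2 * Z :=
    (Blowdown.oscAt_le_oscAt_of_forall hA hIτ v c (θ * R) hpt).trans
      (Blowdown.oscAt_le_two_mul_add hA hIτ v (fun x => v x + z₁ x) z₁ c (θ * R) m' m' hz₁sum fun p _ => by
        show ‖v p - m'‖ ≤ ‖v p + z₁ p - m'‖ + ‖z₁ p‖
        calc ‖v p - m'‖ = ‖(v p + z₁ p - m') - z₁ p‖ := by congr 1; abel
          _ ≤ ‖v p + z₁ p - m'‖ + ‖z₁ p‖ := norm_sub_le _ _)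
  have hO₂ : Blowdown.oscAt S (fun x => v x + z₁ x) c R m ≤ 2 * Blowdown.oscAt S v c (16 * R) m + 2 * Z := by
    have h1 := Blowdown.oscAt_le_two_mul_add hA hIτ (fun x => v x + z₁ x) v z₁ c R m m hz₁sum fun p _ => by
      show ‖v p + z₁ p - m‖ ≤ ‖v p - m‖ + ‖z₁ p‖
      calc ‖v p + z₁ p - m‖ = ‖(v p - m) + z₁ p‖ := by congr 1; abel
        _ ≤ ‖v p - m‖ + ‖z₁ p‖ := norm_add_le _ _
    have h2 := Blowdown.oscAt_mono_radius hA hIτ v c (show R ≤ 16 * R by linarith) m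
    linarith
  have hO16 : Blowdown.oscAt S v c (16 * R) m ≤ 121 / 100 * (32 * (16 * R) ^ 3) :=
    Blowdown.oscAt_le_of_sq_le hA hIτ v (fun p hp => Blowdown.sq_norm_vField_sub_const_le hA hI hIτ hu hm hp)
      (by norm_num) c (by linarith)
  have hO0 : 0 ≤ Blowdown.oscAt S v c (16 * R) m := Blowdown.oscAt_nonneg _ _ _ _ _
  -- the constants replaced by their normalisations `max C 1`
  have hE' : Blowdown.nnEnergy S v c (4 * R) ≤
      max C_C 1 * ((4 * R)⁻¹ ^ 2 * Blowdown.oscAt S v c (16 * R) m + (4 * R)⁻¹ ^ 2) :=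
    hE.trans (mul_le_mul_of_nonneg_right (le_max_left _ _)
      (add_nonneg (mul_nonneg (by positivity) hO0) (by positivity)))
  have hN' : N₁ ≤ max C_R 1 * (Blowdown.nnEnergy S v c (4 * R) + R⁻¹ ^ 2) :=
    hM1.trans (mul_le_mul_of_nonneg_right (le_max_left _ _)
      (add_nonneg (Blowdown.nnEnergy_nonneg _ _ _ _) (by positivity)))
  have hZ' : Z ≤ max C_F 1 * N₁ ^ 2 := hZ.trans (mul_le_mul_of_nonneg_right (le_max_left _ _) (sq_nonneg _))
  have hZb : Z ≤ C₃ * R⁻¹ * (Blowdown.oscAt S v c (16 * R) m + 1) := by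
    rw [hC₃]
    exact Blowdown.z_bound_arith (le_max_right _ _) (le_max_right _ _) (le_max_right _ _) hR1 hO0 hO16 hE'
      hN₁0 hN' hZ'
  have hP : Blowdown.oscAt S (fun x => v x + z₁ x) c (θ * R) m' ≤
      D * ((θ * R / R) ^ 4 * Blowdown.oscAt S (fun x => v x + z₁ x) c R m +
        (θ * R) ^ 5 * (2 ^ 2 * R⁻¹ ^ 6 + Z * R⁻¹ ^ 8)) :=
    hm'.trans (mul_le_mul_of_nonneg_right hDC
      (add_nonneg (mul_nonneg (by positivity) (Blowdown.oscAt_nonneg _ _ _ _ _)) (by positivity)))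
  -- Step 8: assembly
  exact Blowdown.improvement_arith hD1 hθ0 hθ1.le hθD.le hR1 hRZ hO0 hZ0 hZb hO₂ hP hQ

end Summit.AtomisticToContinuum.Crystallization.Theorems.ExcessDecayLiouville

end
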